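import Mathlib

/-!
# Smooth lattice-periodic partition of unity (sector cut-off)

Stub `stub_sectorPartitionOfUnity` (PU) of crux `AnchorGap` (stmt-QuantumFields-11141), line
`registered`.  For `k` linearly independent vectors `b j` of `ℝ^k` and `δ > 0` there is a smooth
`ρ : ℝ^k → [0, 1]`, supported in the image of the enlarged cell `(-δ, 1 + δ)^k`, whose
`Σ ℤ b_j`-translates sum to `1`, with every derivative bounded.  This is the sector cut-off
`χ_h` of Brydges' Peierls expansion (`1 = Σ_h χ(· - h)`), a purely real-analysis fact.

Construction: a smooth monotone step `f` (`f = 0` on `(-∞, -δ/2]`, `f = 1` on `[δ/2, ∞)`,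
from `Real.smoothTransition`), the bump `ψ t = f t - f (t - 1)` (so `0 ≤ ψ ≤ 1`, `ψ` vanishes
off `(-δ/2, 1 + δ/2)` and `Σ_{m ∈ ℤ} ψ (t + m) = 1` telescopes), and `ρ θ = ∏ j ψ (c θ j)` with
`c` the coordinate map of the basis `b`.  All auxiliary functions are kept abstract (hypotheses
`hψ : ∀ t, ψ t = f t - f (t - 1)`, `hρ : ∀ θ, ρ θ = ∏ j, ψ (c θ j)`), so the file declares no
definitions.
-/

set_option autoImplicit false

noncomputable section

open scoped BigOperators

namespace Summit.QuantumFields.YangMills.Theorems.AnchorGap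

section OneDim

variable {δ : ℝ} {f ψ : ℝ → ℝ}

/-- A smooth monotone step of width `δ`: values in `[0, 1]`, equal to `0` on `(-∞, -δ/2]` and to
`1` on `[δ/2, ∞)` (namely `t ↦ smoothTransition ((t + δ/2)/δ)`). [folklore] -/
theorem exists_smoothStep (hδ : 0 < δ) :
    ∃ f : ℝ → ℝ, ContDiff ℝ (⊤ : ℕ∞) f ∧ Monotone f ∧ (∀ t, 0 ≤ f t ∧ f t ≤ 1) ∧
      (∀ t, t ≤ -δ / 2 → f t = 0) ∧ (∀ t, δ / 2 ≤ t → f t = 1) := by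
  refine ⟨fun t => Real.smoothTransition ((t + δ / 2) / δ), ?_, ?_, ?_, ?_, ?_⟩
  · exact Real.smoothTransition.contDiff.comp ((contDiff_id.add contDiff_const).div_const δ)
  · intro s t hst
    exact Real.smoothTransition.monotone (div_le_div_of_nonneg_right (by linarith) hδ.le)
  · exact fun t => ⟨Real.smoothTransition.nonneg _, Real.smoothTransition.le_one _⟩
  · intro t ht
    exact Real.smoothTransition.zero_of_nonpos
      (div_nonpos_of_nonpos_of_nonneg (by linarith) hδ.le)
  · intro t ht
    apply Real.smoothTransition.one_of_one_le
    rw [le_div_iff₀ hδ]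
    linarith

/-- The bump `ψ t = f t - f (t - 1)` is smooth. [folklore] -/
theorem bump_contDiff (hf : ContDiff ℝ (⊤ : ℕ∞) f) (hψ : ∀ t, ψ t = f t - f (t - 1)) :
    ContDiff ℝ (⊤ : ℕ∞) ψ := by
  rw [show ψ = fun t => f t - f (t - 1) from funext hψ]
  exact hf.sub (hf.comp (contDiff_id.sub contDiff_const))

/-- The bump is nonnegative. [folklore] -/
theorem bump_nonneg (hmono : Monotone f) (hψ : ∀ t, ψ t = f t - f (t - 1)) (t : ℝ) :
    0 ≤ ψ t := by
  rw [hψ]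
  have h := hmono (show t - 1 ≤ t by linarith)
  linarith

/-- The bump is at most `1`. [folklore] -/
theorem bump_le_one (h01 : ∀ t, 0 ≤ f t ∧ f t ≤ 1) (hψ : ∀ t, ψ t = f t - f (t - 1)) (t : ℝ) :
    ψ t ≤ 1 := by
  rw [hψ]
  have h1 := (h01 t).2
  have h2 := (h01 (t - 1)).1
  linarith

/-- The bump vanishes on `(-∞, -δ/2]`. [folklore] -/
theorem bump_eq_zero_of_le (hf0 : ∀ t, t ≤ -δ / 2 → f t = 0)
    (hψ : ∀ t, ψ t = f t - f (t - 1)) {t : ℝ} (ht : t ≤ -δ / 2) : ψ t = 0 := by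
  rw [hψ, hf0 t ht, hf0 (t - 1) (by linarith)]
  simp

/-- The bump vanishes on `[1 + δ/2, ∞)`. [folklore] -/
theorem bump_eq_zero_of_ge (hf1 : ∀ t, δ / 2 ≤ t → f t = 1)
    (hψ : ∀ t, ψ t = f t - f (t - 1)) {t : ℝ} (ht : 1 + δ / 2 ≤ t) : ψ t = 0 := by
  rw [hψ, hf1 t (by linarith), hf1 (t - 1) (by linarith)]
  simp

/-- Where the bump is nonzero, the argument lies in `(-δ, 1 + δ)`. [folklore] -/
theorem bump_ne_zero (hδ : 0 < δ) (hf0 : ∀ t, t ≤ -δ / 2 → f t = 0)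
    (hf1 : ∀ t, δ / 2 ≤ t → f t = 1) (hψ : ∀ t, ψ t = f t - f (t - 1)) {t : ℝ}
    (ht : ψ t ≠ 0) : -δ < t ∧ t < 1 + δ := by
  constructor
  · by_contra h
    push Not at h
    exact ht (bump_eq_zero_of_le hf0 hψ (by linarith))
  · by_contra h
    push Not at h
    exact ht (bump_eq_zero_of_ge hf1 hψ (by linarith))

/-- Telescoping of the nonnegative translates. [folklore] -/
theorem sum_range_bump (hψ : ∀ t, ψ t = f t - f (t - 1)) (t : ℝ) (N : ℕ) :
    ∑ i ∈ Finset.range N, ψ (t + i) = f (t + N - 1) - f (t - 1) := by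
  induction N with
  | zero => simp
  | succ n ih =>
    rw [Finset.sum_range_succ, ih]
    have h1 : (t + ((n + 1 : ℕ) : ℝ) - 1) = t + (n : ℝ) := by push_cast; ring
    rw [h1, hψ]
    ring

/-- Telescoping of the negative translates. [folklore] -/
theorem sum_range_bump_neg (hψ : ∀ t, ψ t = f t - f (t - 1)) (t : ℝ) (N : ℕ) :
    ∑ i ∈ Finset.range N, ψ (t - i - 1) = f (t - 1) - f (t - N - 1) := by
  induction N with
  | zero => simp
  | succ n ih =>
    rw [Finset.sum_range_succ, ih]
    have h1 : (t - ((n + 1 : ℕ) : ℝ) - 1) = t - (n : ℝ) - 1 - 1 := by push_cast; ring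
    rw [h1, hψ]
    ring

/-- The `ℤ`-translates of the bump sum to one (a telescoping series with finitely many nonzero
terms). [folklore] -/
theorem hasSum_bump (hδ : 0 < δ) (hf0 : ∀ t, t ≤ -δ / 2 → f t = 0)
    (hf1 : ∀ t, δ / 2 ≤ t → f t = 1) (hψ : ∀ t, ψ t = f t - f (t - 1)) (t : ℝ) :
    HasSum (fun m : ℤ => ψ (t + m)) 1 := by
  obtain ⟨N, hN⟩ := exists_nat_ge (|t| + δ + 2)
  have hle := le_abs_self t
  have hge := neg_abs_le t
  set F : ℤ → ℝ := fun m => ψ (t + m) with hF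
  have hpos : HasSum (fun i : ℕ => F i) (1 - f (t - 1)) := by
    have hF' : ∀ i : ℕ, F i = ψ (t + i) := by
      intro i
      simp only [hF, Int.cast_natCast]
    simp_rw [hF']
    have hvan : ∀ i ∉ Finset.range N, ψ (t + i) = 0 := by
      intro i hi
      rw [Finset.mem_range, not_lt] at hi
      have hi' : (N : ℝ) ≤ i := by exact_mod_cast hi
      exact bump_eq_zero_of_ge hf1 hψ (by linarith)
    have h := hasSum_sum_of_ne_finset_zero (L := SummationFilter.unconditional _) hvan
    rw [sum_range_bump hψ, hf1 _ (by linarith : δ / 2 ≤ t + N - 1)] at h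
    exact h
  have hneg : HasSum (fun i : ℕ => F (-(i + 1))) (f (t - 1)) := by
    have hF' : ∀ i : ℕ, F (-(i + 1)) = ψ (t - i - 1) := by
      intro i
      simp only [hF]
      congr 1
      push_cast
      ring
    simp_rw [hF']
    have hvan : ∀ i ∉ Finset.range N, ψ (t - i - 1) = 0 := by
      intro i hi
      rw [Finset.mem_range, not_lt] at hi
      have hi' : (N : ℝ) ≤ i := by exact_mod_cast hi
      exact bump_eq_zero_of_le hf0 hψ (by linarith)
    have h := hasSum_sum_of_ne_finset_zero (L := SummationFilter.unconditional _) hvan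
    rw [sum_range_bump_neg hψ, hf0 _ (by linarith : t - N - 1 ≤ -δ / 2), sub_zero] at h
    exact h
  have key := HasSum.of_nat_of_neg_add_one hpos hneg
  convert key using 1
  ring

/-- Outside the window `[-N, N]`, `|t| + δ + 2 ≤ N`, the translates of the bump vanish.
[folklore] -/
theorem bump_eq_zero_of_not_mem (hδ : 0 < δ) (hf0 : ∀ t, t ≤ -δ / 2 → f t = 0)
    (hf1 : ∀ t, δ / 2 ≤ t → f t = 1) (hψ : ∀ t, ψ t = f t - f (t - 1)) (t : ℝ) {N : ℕ}
    (hN : |t| + δ + 2 ≤ N) (m : ℤ) (hm : m ∉ Finset.Icc (-(N : ℤ)) N) : ψ (t + m) = 0 := by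
  have hle := le_abs_self t
  have hge := neg_abs_le t
  rw [Finset.mem_Icc, not_and_or, not_le, not_le] at hm
  rcases hm with hm | hm
  · have hm' : (m : ℝ) < -(N : ℝ) := by exact_mod_cast hm
    exact bump_eq_zero_of_le hf0 hψ (by linarith)
  · have hm' : (N : ℝ) < (m : ℝ) := by exact_mod_cast hm
    exact bump_eq_zero_of_ge hf1 hψ (by linarith)

/-- The finite window sum of the translates of the bump equals one. [folklore] -/
theorem sum_Icc_bump (hδ : 0 < δ) (hf0 : ∀ t, t ≤ -δ / 2 → f t = 0)
    (hf1 : ∀ t, δ / 2 ≤ t → f t = 1) (hψ : ∀ t, ψ t = f t - f (t - 1)) (t : ℝ) {N : ℕ}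
    (hN : |t| + δ + 2 ≤ N) : ∑ m ∈ Finset.Icc (-(N : ℤ)) N, ψ (t + m) = 1 :=
  (hasSum_sum_of_ne_finset_zero (bump_eq_zero_of_not_mem hδ hf0 hf1 hψ t hN)).unique
    (hasSum_bump hδ hf0 hf1 hψ t)

/-- The `ℤ^k`-translates of the product bump sum to one (the sum has finite support and
factorises over the coordinates). [folklore] -/
theorem hasSum_prod_bump {k : ℕ} (hδ : 0 < δ) (hf0 : ∀ t, t ≤ -δ / 2 → f t = 0)
    (hf1 : ∀ t, δ / 2 ≤ t → f t = 1) (hψ : ∀ t, ψ t = f t - f (t - 1)) (t : Fin k → ℝ) :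
    HasSum (fun n : Fin k → ℤ => ∏ j, ψ (t j + n j)) 1 := by
  choose N hN using fun j : Fin k => exists_nat_ge (|t j| + δ + 2)
  have hvan : ∀ n ∉ Fintype.piFinset (fun j => Finset.Icc (-(N j : ℤ)) (N j)),
      (∏ j, ψ (t j + n j)) = 0 := by
    intro n hn
    rw [Fintype.mem_piFinset] at hn
    push Not at hn
    obtain ⟨j, hj⟩ := hn
    exact Finset.prod_eq_zero (Finset.mem_univ j)
      (bump_eq_zero_of_not_mem hδ hf0 hf1 hψ _ (hN j) _ hj)
  have h := hasSum_sum_of_ne_finset_zero (L := SummationFilter.unconditional _) hvan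
  rw [← Finset.prod_univ_sum (fun j => Finset.Icc (-(N j : ℤ)) (N j))
    (fun j (m : ℤ) => ψ (t j + m)), Finset.prod_eq_one] at h
  · exact h
  · intro j _
    exact sum_Icc_bump hδ hf0 hf1 hψ _ (hN j)

end OneDim

section Prod

variable {k : ℕ} {δ : ℝ} {ψ : ℝ → ℝ} {ρ : (Fin k → ℝ) → ℝ}

/-- The product bump `ρ θ = ∏ j ψ (c θ j)` in linear coordinates `c` is smooth. [folklore] -/
theorem rho_contDiff (hψc : ContDiff ℝ (⊤ : ℕ∞) ψ) (c : (Fin k → ℝ) ≃L[ℝ] (Fin k → ℝ))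
    (hρ : ∀ θ, ρ θ = ∏ j, ψ (c θ j)) : ContDiff ℝ (⊤ : ℕ∞) ρ := by
  rw [show ρ = fun θ => ∏ j, ψ (c θ j) from funext hρ]
  apply contDiff_prod
  intro j _
  exact hψc.comp ((contDiff_apply ℝ ℝ j).comp c.contDiff)

/-- The product bump takes values in `[0, 1]`. [folklore] -/
theorem rho_mem (h0 : ∀ t, 0 ≤ ψ t) (h1 : ∀ t, ψ t ≤ 1) (c : (Fin k → ℝ) ≃L[ℝ] (Fin k → ℝ))
    (hρ : ∀ θ, ρ θ = ∏ j, ψ (c θ j)) (θ : Fin k → ℝ) : 0 ≤ ρ θ ∧ ρ θ ≤ 1 := by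
  rw [hρ]
  exact ⟨Finset.prod_nonneg fun _ _ => h0 _, Finset.prod_le_one (fun _ _ => h0 _) fun _ _ => h1 _⟩

/-- Where the product bump is nonzero, all coordinates lie in `(-δ, 1 + δ)`. [folklore] -/
theorem rho_ne_zero (hne : ∀ t, ψ t ≠ 0 → -δ < t ∧ t < 1 + δ)
    (c : (Fin k → ℝ) ≃L[ℝ] (Fin k → ℝ)) (hρ : ∀ θ, ρ θ = ∏ j, ψ (c θ j)) (θ : Fin k → ℝ)
    (hθ : ρ θ ≠ 0) (j : Fin k) : -δ < c θ j ∧ c θ j < 1 + δ := by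
  apply hne
  intro h0
  rw [hρ] at hθ
  exact hθ (Finset.prod_eq_zero (Finset.mem_univ j) h0)

/-- The product bump has compact support (inside the image of the closed enlarged cell under
`c.symm`), hence bounded derivatives of every order. [folklore] -/
theorem rho_iteratedFDeriv_bounded (hψc : ContDiff ℝ (⊤ : ℕ∞) ψ)
    (hne : ∀ t, ψ t ≠ 0 → -δ < t ∧ t < 1 + δ) (c : (Fin k → ℝ) ≃L[ℝ] (Fin k → ℝ))
    (hρ : ∀ θ, ρ θ = ∏ j, ψ (c θ j)) (m : ℕ) :
    ∃ K : ℝ, ∀ θ : Fin k → ℝ, ‖iteratedFDeriv ℝ m ρ θ‖ ≤ K := by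
  have hK : IsCompact (c.symm '' Set.Icc (fun _ => -δ) (fun _ => 1 + δ)) :=
    isCompact_Icc.image c.symm.continuous
  have hcpt : HasCompactSupport ρ := by
    refine HasCompactSupport.intro hK ?_
    intro θ hθ
    by_contra hne'
    apply hθ
    refine ⟨c θ, ?_, c.symm_apply_apply θ⟩
    have h := rho_ne_zero hne c hρ θ hne'
    exact ⟨fun j => (h j).1.le, fun j => (h j).2.le⟩
  have hcont : Continuous (fun θ => iteratedFDeriv ℝ m ρ θ) :=
    (rho_contDiff hψc c hρ).continuous_iteratedFDeriv (by exact_mod_cast le_top)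
  exact hcont.bounded_above_of_compact_support (hcpt.iteratedFDeriv m)

/-- Coordinates with respect to `k` linearly independent vectors of `ℝ^k` (a basis):
`θ = Σ_j (c θ)_j b_j`, and translating by a lattice vector shifts the coordinates. [folklore] -/
theorem exists_coord {b : Fin k → Fin k → ℝ} (hb : LinearIndependent ℝ b) :
    ∃ c : (Fin k → ℝ) ≃L[ℝ] (Fin k → ℝ),
      (∀ θ : Fin k → ℝ, θ = fun a => ∑ j, c θ j * b j a) ∧
      (∀ (θ : Fin k → ℝ) (n : Fin k → ℤ),
        c (fun a => θ a + ∑ j, (n j : ℝ) * b j a) = fun j => c θ j + n j) := by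
  classical
  let B : Module.Basis (Fin k) ℝ (Fin k → ℝ) := basisOfPiSpaceOfLinearIndependent hb
  have hB : ⇑B = b := coe_basisOfPiSpaceOfLinearIndependent hb
  have hc : ∀ θ : Fin k → ℝ, (B.equivFunL θ : Fin k → ℝ) = B.equivFun θ := fun θ => rfl
  refine ⟨B.equivFunL, ?_, ?_⟩
  · intro θ
    have h := B.sum_equivFun θ
    funext a
    have ha := congrFun h a
    simp only [Finset.sum_apply, Pi.smul_apply, smul_eq_mul, hB] at ha
    rw [hc]
    exact ha.symm
  · intro θ n
    have h1 : (fun a => θ a + ∑ j, (n j : ℝ) * b j a) = θ + ∑ j, ((n j : ℝ)) • B j := by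
      funext a
      simp [Finset.sum_apply, Pi.smul_apply, smul_eq_mul, hB]
    rw [h1, map_add]
    have h2 : B.equivFunL (∑ j, ((n j : ℝ)) • B j) = fun j => (n j : ℝ) := by
      have h3 := B.equivFun.apply_symm_apply (fun j => (n j : ℝ))
      simp only [Module.Basis.equivFun_symm_apply] at h3
      rw [hc]
      exact h3
    rw [h2]
    rfl

end Prod

/-- **Stub PU — smooth lattice-periodic partition of unity subordinate to enlarged cells
(the sector cut-off `χ_h` of the Peierls expansion, `1 = Σ_h χ(· - h)`).**
For `k` linearly independent vectors `b j ∈ ℝ^k` and `δ > 0` there is a smooth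
`ρ : ℝ^k → [0, 1]` with `ρ θ ≠ 0` only for `θ = Σ t_j b_j`, `t ∈ (-δ, 1 + δ)^k`, with
`Σ_{n ∈ ℤ^k} ρ (θ + Σ n_j b_j) = 1` for every `θ`, and with every derivative bounded.
Proof: `ρ θ = ∏_j ψ ((c θ)_j)` for the telescoping bump `ψ t = f t - f (t - 1)` of a smooth
monotone step `f` (`0` below `-δ/2`, `1` above `δ/2`) and the coordinate map `c` of the basis `b`;
`ρ` has compact support, so every `iteratedFDeriv` is continuous with compact support.
[cite: Brydges1978, §3.1 (3.1)] -/
theorem stub_sectorPartitionOfUnity : ∀ (k : ℕ) (b : Fin k → Fin k → ℝ), LinearIndependent ℝ b → ∀ δ : ℝ, 0 < δ → ∃ ρ : (Fin k → ℝ) → ℝ, ContDiff ℝ (⊤ : ℕ∞) ρ ∧ (∀ θ : Fin k → ℝ, 0 ≤ ρ θ ∧ ρ θ ≤ 1) ∧ (∀ θ : Fin k → ℝ, ρ θ ≠ 0 → ∃ t : Fin k → ℝ, (∀ j : Fin k, -δ < t j ∧ t j < 1 + δ) ∧ θ = fun a => ∑ j : Fin k, t j * b j a) ∧ (∀ θ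 : Fin k → ℝ, HasSum (fun n : Fin k → ℤ => ρ (fun a => θ a + ∑ j : Fin k, (n j : ℝ) * b j a)) 1) ∧ (∀ m : ℕ, ∃ K : ℝ, ∀ θ : Fin k → ℝ, ‖iteratedFDeriv ℝ m ρ θ‖ ≤ K) := by
  intro k b hb δ hδ
  obtain ⟨f, hfc, hmono, h01, hf0, hf1⟩ := exists_smoothStep hδ
  obtain ⟨ψ, hψ⟩ : ∃ ψ : ℝ → ℝ, ∀ t, ψ t = f t - f (t - 1) := ⟨_, fun _ => rfl⟩
  obtain ⟨c, hc1, hc2⟩ := exists_coord hb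
  obtain ⟨ρ, hρ⟩ : ∃ ρ : (Fin k → ℝ) → ℝ, ∀ θ, ρ θ = ∏ j, ψ (c θ j) := ⟨_, fun _ => rfl⟩
  have hne : ∀ t, ψ t ≠ 0 → -δ < t ∧ t < 1 + δ := fun _ ht => bump_ne_zero hδ hf0 hf1 hψ ht
  refine ⟨ρ, rho_contDiff (bump_contDiff hfc hψ) c hρ,
    rho_mem (bump_nonneg hmono hψ) (bump_le_one h01 hψ) c hρ, ?_, ?_,
    rho_iteratedFDeriv_bounded (bump_contDiff hfc hψ) hne c hρ⟩
  · intro θ hθ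
    exact ⟨c θ, rho_ne_zero hne c hρ θ hθ, hc1 θ⟩
  · intro θ
    have h : (fun n : Fin k → ℤ => ρ (fun a => θ a + ∑ j, (n j : ℝ) * b j a)) =
        fun n => ∏ j, ψ (c θ j + n j) := by
      funext n
      rw [hρ, hc2]
    rw [h]
    exact hasSum_prod_bump hδ hf0 hf1 hψ (c θ)

end Summit.QuantumFields.YangMills.Theorems.AnchorGap

end
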